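import Summits.ValiantsHypothesis.ValiantsHypothesis.Theorems.GrenetZeonTwoDimCoefficientsUnitCase
import Literature.Computability.AlgebraicComplexity.HessianRank
import HarnessLib

/-!
# Crux `GrenetZeon.TwoDimCoefficients` (stmt-ValiantsHypothesis-8062), line `dim2_cases`:
# the reduced unit case, part 2 — rescaling and restriction to a coordinate line

Second of three files proving the REDUCED unit case (`det A = c + per_n·q`, `per_n ∤ top(q)`
`⇒ n² ≤ 2m + 2`, assembled in `…UnitReducedTop`).  This file:

* STEP 2, RESCALING.  With `q̂_ε := Σ_e ε^{k-e} q_e` (`q_e` the homogeneous components of `q`,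
  `k = deg q`) and `ĝ_ε := c ε^{n+k} + per_n · q̂_ε` one has `ĝ_ε(x) = ε^{n+k} det A(x/ε)`
  (`eval_rescale_identity`, `eval_det_rescale`), and `ĝ_ε` is again an affine `m × m` determinant:
  multiply the constant parts of the entries of `A` by `ε` (`mapMatrix_eval_rescale`,
  `isAffine_rescale`) and one row by `ε^{n+k-m}` (`hasAffineDetRepr_rescale`; the polynomial identity
  `det A^ε = ε^{m-n-k} ĝ_ε` is checked pointwise, `MvPolynomial.funext`).
* STEP 4 (algebra), THE LINE `τ ↦ p + τ eᵢ` as a substitution into `ℂ[τ]`: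
  `eval_aeval_lineMap` (values), `coeff_zero_aeval_lineMap` (`h(0) = f(p)`),
  `coeff_one_aeval_lineMap` (`h'(0) = ∂ᵢf(p)`).

HONEST FRAMING: helper lemmas for an ASIDE item; `VP ≠ VNP` is not moved.

References: T. Mignon, N. Ressayre, Int. Math. Res. Not. 2004:79, Thm. 1.1.
-/

set_option linter.dupNamespace false

noncomputable section

namespace Summit.ValiantsHypothesis.ValiantsHypothesis.Cruxes.TwoDimCoefficients.DimTwoCases

open MvPolynomial Matrix
open Literature.Computability.AlgebraicComplexity

/-! ### Step 2: rescaling — `ĝ_ε(x) = ε^D det A(x/ε)` is again an affine determinant -/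

section Rescale

variable {σ : Type*}

/-- The linear part of an affine polynomial is a linear form. -/
theorem isHomogeneous_one_sub_C_coeff_zero (f : MvPolynomial σ ℂ) (hf : f.totalDegree ≤ 1) :
    (f - C (coeff 0 f)).IsHomogeneous 1 := by
  classical
  have hsum := sum_homogeneousComponent f
  rcases Nat.le_one_iff_eq_zero_or_eq_one.mp hf with h0 | h1
  · rw [h0, zero_add, Finset.sum_range_one, homogeneousComponent_zero] at hsum
    have : f - C (coeff 0 f) = 0 := by
      calc f - C (coeff 0 f) = C (coeff 0 f) - C (coeff 0 f) := by rw [hsum]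
        _ = 0 := sub_self _
    rw [this]
    exact isHomogeneous_zero σ ℂ 1
  · rw [h1, Finset.sum_range_succ, Finset.sum_range_one, homogeneousComponent_zero] at hsum
    have : f - C (coeff 0 f) = homogeneousComponent 1 f := by
      calc f - C (coeff 0 f) = (C (coeff 0 f) + homogeneousComponent 1 f) - C (coeff 0 f) := by
            rw [hsum]
        _ = homogeneousComponent 1 f := by ring
    rw [this]
    exact homogeneousComponent_isHomogeneous 1 f

variable [Fintype σ]

/-- Scaling the constant part of an affine polynomial by `ε`: `f + (ε-1) f(0)` takes at `x` the value
`ε · f(x/ε)`. -/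
theorem eval_add_C_mul_coeff_zero (f : MvPolynomial σ ℂ) (hf : f.totalDegree ≤ 1) {ε : ℂ}
    (hε : ε ≠ 0) (x : σ → ℂ) :
    eval x (f + C ((ε - 1) * coeff 0 f)) = ε * eval (ε⁻¹ • x) f := by
  have hlin := isHomogeneous_one_sub_C_coeff_zero f hf
  have h1 : eval (ε⁻¹ • x) (f - C (coeff 0 f)) = ε⁻¹ * eval x (f - C (coeff 0 f)) := by
    have := eval_smul_of_isHomogeneous _ hlin ε⁻¹ x
    rwa [pow_one] at this
  have hval : eval x f = coeff 0 f + eval x (f - C (coeff 0 f)) := by rw [map_sub, eval_C]; ring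
  have hval' : eval (ε⁻¹ • x) f = coeff 0 f + ε⁻¹ * eval x (f - C (coeff 0 f)) := by
    rw [← h1, map_sub, eval_C]; ring
  rw [map_add, eval_C, hval', hval, mul_add, ← mul_assoc, mul_inv_cancel₀ hε, one_mul]
  ring

variable {n m : ℕ}

/-- The rescaled matrix `A^ε`: constant parts of the entries multiplied by `ε`.  At `x` it is
`ε · A(x/ε)`. -/
theorem mapMatrix_eval_rescale (A : AffMat n m) (hA : IsAffine A) {ε : ℂ} (hε : ε ≠ 0)
    (x : Fin n × Fin n → ℂ) :
    (eval x).mapMatrix (Matrix.of fun i j => A i j + C ((ε - 1) * coeff 0 (A i j))) =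
      ε • (eval (ε⁻¹ • x)).mapMatrix A := by
  ext i j
  simp only [RingHom.mapMatrix_apply, Matrix.map_apply, Matrix.of_apply, Matrix.smul_apply,
    smul_eq_mul]
  exact eval_add_C_mul_coeff_zero _ (hA i j) hε x

/-- The rescaled matrix is affine. -/
theorem isAffine_rescale (A : AffMat n m) (hA : IsAffine A) (ε : ℂ) :
    IsAffine (Matrix.of fun i j => A i j + C ((ε - 1) * coeff 0 (A i j)) : AffMat n m) := by
  intro i j
  rw [Matrix.of_apply]
  refine (totalDegree_add _ _).trans (max_le (hA i j) ?_)
  rw [totalDegree_C]; exact Nat.zero_le _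

/-- Value of the determinant of the rescaled matrix: `det A^ε (x) = ε^m · det A (x/ε)`. -/
theorem eval_det_rescale (A : AffMat n m) (hA : IsAffine A) {ε : ℂ} (hε : ε ≠ 0)
    (x : Fin n × Fin n → ℂ) :
    eval x (Matrix.of fun i j => A i j + C ((ε - 1) * coeff 0 (A i j)) : AffMat n m).det =
      ε ^ m * eval (ε⁻¹ • x) A.det := by
  rw [RingHom.map_det, mapMatrix_eval_rescale A hA hε, Matrix.det_smul, Fintype.card_fin,
    RingHom.map_det]

/-- The rescaled cofactor `q̂_ε = Σ_e ε^{k-e} q_e` evaluates to `ε^k q(x/ε)`… precisely: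
`ε^{n+k} · (c + per(x/ε) q(x/ε)) = c ε^{n+k} + per(x) · q̂_ε(x)`. -/
theorem eval_rescale_identity (c : ℂ) (q : MvPolynomial (Fin n × Fin n) ℂ) {ε : ℂ}
    (hε : ε ≠ 0) (x : Fin n × Fin n → ℂ) :
    ε ^ (n + q.totalDegree) * eval (ε⁻¹ • x) (C c + perPoly (Fin n) ℂ * q) =
      eval x (C (c * ε ^ (n + q.totalDegree)) + perPoly (Fin n) ℂ *
        ∑ e ∈ Finset.range (q.totalDegree + 1),
          C (ε ^ (q.totalDegree - e)) * homogeneousComponent e q) := by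
  set kq := q.totalDegree with hkq
  have hq : eval (ε⁻¹ • x) q =
      ∑ e ∈ Finset.range (kq + 1), (ε⁻¹) ^ e * eval x (homogeneousComponent e q) := by
    conv_lhs => rw [← sum_homogeneousComponent q]
    rw [map_sum]
    refine Finset.sum_congr rfl fun e _ => ?_
    exact eval_smul_of_isHomogeneous _ (homogeneousComponent_isHomogeneous e q) _ _
  rw [map_add, eval_C, map_mul, eval_smul_perPoly, hq, map_add, eval_C, map_mul, map_sum,
    mul_add, Finset.mul_sum, Finset.mul_sum, Finset.mul_sum]
  congr 1
  · ring
  · refine Finset.sum_congr rfl fun e he => ?_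
    have he' : e ≤ kq := Nat.lt_succ_iff.mp (Finset.mem_range.mp he)
    rw [map_mul, eval_C]
    have hpow : ε ^ (n + kq) = ε ^ (kq - e) * (ε ^ e * ε ^ n) := by
      rw [← pow_add, ← pow_add]; congr 1; omega
    rw [hpow]
    have h1 : ε ^ e * (ε⁻¹) ^ e = 1 := by rw [← mul_pow, mul_inv_cancel₀ hε, one_pow]
    have h2 : ε ^ n * (ε⁻¹) ^ n = 1 := by rw [← mul_pow, mul_inv_cancel₀ hε, one_pow]
    calc ε ^ (kq - e) * (ε ^ e * ε ^ n) *
          ((ε⁻¹) ^ n * eval x (perPoly (Fin n) ℂ) * ((ε⁻¹) ^ e * eval x (homogeneousComponent e q)))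
        = ε ^ (kq - e) * (ε ^ e * (ε⁻¹) ^ e) * (ε ^ n * (ε⁻¹) ^ n) *
          (eval x (perPoly (Fin n) ℂ) * eval x (homogeneousComponent e q)) := by ring
      _ = eval x (perPoly (Fin n) ℂ) * (ε ^ (kq - e) * eval x (homogeneousComponent e q)) := by
          rw [h1, h2]; ring

/-- **Step 2.** For `ε ≠ 0`, the rescaled polynomial `ĝ_ε = c ε^D + per · q̂_ε` has an affine
determinantal representation of size `m` (given `det A = c + per·q`, `q ≠ 0`). -/
theorem hasAffineDetRepr_rescale (A : AffMat n m) (hA : IsAffine A) (hn : 0 < n) {c : ℂ}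
    {q : MvPolynomial (Fin n × Fin n) ℂ} (hq : q ≠ 0)
    (hdet : A.det = C c + perPoly (Fin n) ℂ * q) {ε : ℂ} (hε : ε ≠ 0) :
    ∃ B : AffMat n m, IsAffineDetRepr
      (C (c * ε ^ (n + q.totalDegree)) + perPoly (Fin n) ℂ *
        ∑ e ∈ Finset.range (q.totalDegree + 1),
          C (ε ^ (q.totalDegree - e)) * homogeneousComponent e q) B := by
  classical
  set D := n + q.totalDegree with hD
  set ghat := C (c * ε ^ D) + perPoly (Fin n) ℂ *
        ∑ e ∈ Finset.range (q.totalDegree + 1),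
          C (ε ^ (q.totalDegree - e)) * homogeneousComponent e q with hghat
  have hDm : D ≤ m := add_totalDegree_le_of_det_eq hn A hA hq hdet
  set Aε : AffMat n m := Matrix.of fun i j => A i j + C ((ε - 1) * coeff 0 (A i j)) with hAε
  -- `det A^ε = ε^{m-D} · ĝ_ε`
  have hdetε : Aε.det = C (ε ^ (m - D)) * ghat := by
    apply MvPolynomial.funext
    intro x
    rw [hAε, eval_det_rescale A hA hε, map_mul, eval_C, hghat, hD, hdet,
      ← eval_rescale_identity c q hε x, ← mul_assoc, ← pow_add]
    congr 2
    omega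
  -- scale one row by `ε^{D-m}`
  have hm : 0 < m := by omega
  let i₀ : Fin m := ⟨0, hm⟩
  refine ⟨Aε.updateRow i₀ ((C ((ε⁻¹) ^ (m - D)) : MvPolynomial (Fin n × Fin n) ℂ) • Aε i₀),
    fun i j => ?_, ?_⟩
  · rw [Matrix.updateRow_apply]
    split_ifs with h
    · rw [Pi.smul_apply, smul_eq_mul]
      refine (totalDegree_mul _ _).trans ?_
      rw [totalDegree_C, zero_add]
      exact isAffine_rescale A hA ε i₀ j
    · exact isAffine_rescale A hA ε i j
  · rw [Matrix.det_updateRow_smul, Matrix.updateRow_eq_self, hdetε, ← mul_assoc, ← map_mul,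
      ← mul_pow, inv_mul_cancel₀ hε, one_pow, map_one, one_mul]

end Rescale

/-! ### Step 4 (algebra): restriction to a coordinate line -/

section Line

variable {σ : Type*} [DecidableEq σ]

/-- Values on the line. -/
theorem eval_aeval_lineMap (p : σ → ℂ) (i : σ) (f : MvPolynomial σ ℂ) (τ : ℂ) :
    Polynomial.eval τ (aeval (fun j => Polynomial.C (p j) + Pi.single (M := fun _ => Polynomial ℂ) i Polynomial.X j) f) =
      eval (p + τ • Pi.single i 1) f := by
  have h : (Polynomial.evalRingHom τ).comp (aeval (R := ℂ) (fun j => Polynomial.C (p j) + Pi.single (M := fun _ => Polynomial ℂ) i Polynomial.X j)).toRingHom =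
      eval (p + τ • Pi.single (M := fun _ => ℂ) i 1) := by
    refine MvPolynomial.ringHom_ext (fun a => ?_) (fun j => ?_)
    · simp
    · simp only [RingHom.coe_comp, Function.comp_apply, AlgHom.toRingHom_eq_coe, RingHom.coe_coe,
        aeval_X, Polynomial.coe_evalRingHom, eval_X, Pi.add_apply, Pi.smul_apply, smul_eq_mul,
        Polynomial.eval_add, Polynomial.eval_C]
      by_cases hj : j = i
      · subst hj; simp
      · simp [Pi.single_eq_of_ne hj]
  exact RingHom.congr_fun h f

/-- The constant coefficient on the line is the value at the base point. -/
theorem coeff_zero_aeval_lineMap (p : σ → ℂ) (i : σ) (f : MvPolynomial σ ℂ) :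
    (aeval (fun j => Polynomial.C (p j) + Pi.single (M := fun _ => Polynomial ℂ) i Polynomial.X j) f).coeff 0 = eval p f := by
  rw [Polynomial.coeff_zero_eq_eval_zero, eval_aeval_lineMap, zero_smul, add_zero]

/-- The linear coefficient on the line is the partial derivative at the base point. -/
theorem coeff_one_aeval_lineMap (p : σ → ℂ) (i : σ) (f : MvPolynomial σ ℂ) :
    (aeval (fun j => Polynomial.C (p j) + Pi.single (M := fun _ => Polynomial ℂ) i Polynomial.X j) f).coeff 1 = eval p (pderiv i f) := by
  induction f using MvPolynomial.induction_on with
  | C a =>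
    rw [aeval_C, Polynomial.algebraMap_eq, Polynomial.coeff_C, if_neg one_ne_zero, pderiv_C,
      map_zero]
  | add f g hf hg => rw [map_add, Polynomial.coeff_add, hf, hg, map_add, map_add]
  | mul_X f j hf =>
    rw [map_mul, aeval_X, (pderiv i).leibniz, pderiv_X, smul_eq_mul, smul_eq_mul, map_add,
      map_mul, map_mul, eval_X, ← coeff_zero_aeval_lineMap p i f, ← hf]
    simp only [mul_add, Polynomial.coeff_add, Polynomial.coeff_mul_C]
    by_cases hj : j = i
    · subst hj
      simp only [Pi.single_eq_same, Polynomial.coeff_mul_X, map_one, mul_one]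
      ring
    · simp [Pi.single_eq_of_ne hj]
      ring

end Line

end Summit.ValiantsHypothesis.ValiantsHypothesis.Cruxes.TwoDimCoefficients.DimTwoCases
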